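import Mathlib
import Literature.Analysis.PDE.Wave1DNearWindowedChannelSharp
import HarnessLib

/-!
# The windowed channel inequality on the growing side of a potential: VARIABLE growth rate

Analysis/PDE support file (everything proved, no definitions). Sequel to
`Wave1DNearWindowedChannelSharp.lean`: the growth hypothesis on the potential is relaxed from a
constant rate `V′ ≥ 2κV` to a position-dependent one,

  `V′(x) ≥ 2 k(x) V(x)`  for `x ≤ x_w`,  `k ≥ 0` continuous and NON-INCREASING,

and the constant of the two-ended windowed channel inequality for data supported in
`(−∞, x_w − h]` becomes

  `c = (1 − 2θ)/(1 − θ)`,  `θ = exp(−∫_{x_w−h}^{x_w} k)`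

(`wave1D_nearWindowedChannel_variable`): the lag needed is `∫_{x_e}^{x_w} k > log 2`, however slowly
`k` decays. When `k = (log V)′/2` is itself non-increasing (log-concave side of a single-humped
barrier, e.g. the horizon side of the Regge–Wheeler potentials up to `r = 8M/3`) this reads
`θ = (V(x_e)/V(x_w))^{1/2}`: the near window from the top `x_w` catches the fraction `c > 0` of the
energy of every datum supported where `V < V(x_w)/4`. Route PhotonSphereChannels, crux
`WindowedShellChannels` (stmt-FinalStateConjecture-14085): near half for moderately thick shells with
the window top at the shoulder of the barrier instead of deep in the exponential region.

Method: as in the sharp file, with the optimal ODE weight `β(v) = α₀(1 − e^{−K(v)})₊`,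
`K(v) = ∫_{x_e}^{v} k`, so that `β′ = k(v)(α₀ − β)`; at a bulk point `(τ, x)`, `τ ≥ 0`, monotonicity
of `k` gives `k(τ + x) ≤ k(x)` and hence the signed bulk `(α₀ − β)(2k(τ+x)V − V′)ψ² ≤ 0`; the kink at
`v = x_e` is again realised by three smooth-weight trapezoid identities.

References: multiplier method folklore (S. Alinhac, *Hyperbolic Partial Differential Equations*,
2009, Ch. 6); statement recorded here with its proof.
-/

noncomputable section

namespace Literature.Analysis.PDE

open MeasureTheory Set Filter Topology intervalIntegral Literature.Analysis.Calculus

section Variable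

variable {V : ℝ → ℝ} {ψ : ℝ → ℝ → ℝ}

/-- **The ODE weight.** For `k ≥ 0` continuous, `α₀ ≥ 0` and `x_e ∈ ℝ`, the function
`β(v) = α₀(1 − exp(−∫_{x_e}^{v} k))` is `C¹`, vanishes at `x_e`, is non-negative on `[x_e, ∞)`, at
most `α₀`, satisfies `β′ = k(α₀ − β)`, and `β(x_w) ≥ 1` as soon as `α₀(1 − exp(−∫_{x_e}^{x_w} k)) ≥ 1`.
[folklore] -/
theorem exists_odeWeight {k : ℝ → ℝ} (hk : Continuous k) (hk0 : ∀ x, 0 ≤ k x) (xe : ℝ) {α₀ : ℝ}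
    (hα0 : 0 ≤ α₀) {xw : ℝ} (hαw : 1 ≤ α₀ * (1 - Real.exp (-(∫ y in xe..xw, k y)))) :
    ∃ β : ℝ → ℝ, ContDiff ℝ 1 β ∧ β xe = 0 ∧ (∀ v, xe ≤ v → 0 ≤ β v) ∧ (∀ v, β v ≤ α₀)
      ∧ (∀ v, deriv β v ≤ k v * (α₀ - β v)) ∧ 1 ≤ β xw := by
  set K : ℝ → ℝ := fun v => ∫ y in xe..v, k y with hK
  have hKd : ∀ v, HasDerivAt K (k v) v := fun v =>
    intervalIntegral.integral_hasDerivAt_right (hk.intervalIntegrable _ _)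
      hk.aestronglyMeasurable.stronglyMeasurableAtFilter hk.continuousAt
  set β : ℝ → ℝ := fun v => α₀ * (1 - Real.exp (-K v)) with hβ
  have hβd : ∀ v, HasDerivAt β (k v * (α₀ - β v)) v := by
    intro v
    have hE : HasDerivAt (fun w => Real.exp (-K w)) (Real.exp (-K v) * -k v) v :=
      (Real.hasDerivAt_exp _).comp v (hKd v).neg
    have h := ((hasDerivAt_const v (1 : ℝ)).sub hE).const_mul α₀
    refine h.congr_deriv ?_
    simp only [hβ]
    ring
  have hβdiff : Differentiable ℝ β := fun v => (hβd v).differentiableAt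
  have hβ' : ∀ v, deriv β v = k v * (α₀ - β v) := fun v => (hβd v).deriv
  have hβ'c : Continuous (deriv β) := by
    have : deriv β = fun v => k v * (α₀ - β v) := funext hβ'
    rw [this]
    exact hk.mul (continuous_const.sub hβdiff.continuous)
  have hβC : ContDiff ℝ 1 β := by
    rw [show (1 : WithTop ℕ∞) = 0 + 1 from rfl, contDiff_succ_iff_deriv]
    exact ⟨hβdiff, by simp, contDiff_zero.2 hβ'c⟩
  have hKnn : ∀ v, xe ≤ v → 0 ≤ K v := fun v hv =>
    intervalIntegral.integral_nonneg hv fun y _ => hk0 y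
  refine ⟨β, hβC, ?_, ?_, ?_, fun v => (hβ' v).le, ?_⟩
  · have hKe : K xe = 0 := by simp [hK]
    simp [hβ, hKe]
  · intro v hv
    simp only [hβ]
    apply mul_nonneg hα0
    rw [sub_nonneg, Real.exp_le_one_iff]
    linarith [hKnn v hv]
  · intro v
    simp only [hβ]
    have := Real.exp_pos (-K v)
    nlinarith
  · simpa only [hβ] using hαw

/-- **Roof-flux bound for an admissible weight (variable rate).** Let `V ∈ C¹`, `V ≥ 0`, `k ≥ 0`
non-increasing with `V′ ≥ 2kV` on `(−∞, x_w]`, `x_e ≤ x_w`, and let `β ∈ C¹`, `α₀ ≥ 0` satisfy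
`β(x_e) = 0`, `0 ≤ β` on `[x_e, ∞)`, `β ≤ α₀`, `β′ ≤ k(α₀ − β)` and `β(x_w) ≥ 1`. Then for every `C²`
solution of `ψ_tt − ψ_xx + Vψ = 0` whose Cauchy data vanish on `[x_e, ∞)`, every `t ≥ 0` and every
`b + t ≤ x_e − t`:
`∫_{x_w−t}^{x_w} [(ψ_t − ψ_x)² + Vψ²](x_w − x, x) dx ≤ (α₀/2) ∫_b^{x_e} [(ψ_t − ψ_x)² + Vψ²](0, x) dx`
(three smooth-weight trapezoid identities: `β` on `[b, x_w]` and on `[b, x_e]`, `0` on `[b, x_e]`; at a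
bulk point `(τ, x)` with `τ ≥ 0` one uses `k(τ + x) ≤ k(x)`). [folklore] -/
theorem wave1D_roofFlux_le_of_weight (hV : ContDiff ℝ 1 V) (hV0 : ∀ x, 0 ≤ V x) {k : ℝ → ℝ}
    {xe xw : ℝ} (hk0 : ∀ x, 0 ≤ k x) (hka : Antitone k) (hmono : ∀ x, x ≤ xw → 2 * k x * V x ≤ deriv V x)
    (hew : xe ≤ xw) {α₀ : ℝ} (hα0 : 0 ≤ α₀) {β : ℝ → ℝ} (hβC : ContDiff ℝ 1 β) (hβe : β xe = 0)
    (hβpos : ∀ v, xe ≤ v → 0 ≤ β v) (hβle : ∀ v, β v ≤ α₀)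
    (hβ' : ∀ v, deriv β v ≤ k v * (α₀ - β v)) (hβw : 1 ≤ β xw)
    (hψ : ContDiff ℝ 2 (Function.uncurry ψ))
    (hsol : ∀ t x, iteratedDeriv 2 (fun τ => ψ τ x) t - iteratedDeriv 2 (ψ t) x + V x * ψ t x = 0)
    (hsupp : ∀ x, xe ≤ x → ψ 0 x = 0 ∧ deriv (fun τ => ψ τ x) 0 = 0)
    {b t : ℝ} (ht : 0 ≤ t) (hb : b + t ≤ xe - t) :
    ∫ x in (xw - t)..xw, ((deriv (fun τ => ψ τ x) (xw - x) - deriv (ψ (xw - x)) x) ^ 2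
        + V x * ψ (xw - x) x ^ 2)
      ≤ (α₀ / 2) * ∫ x in b..xe,
        ((deriv (fun τ => ψ τ x) 0 - deriv (ψ 0) x) ^ 2 + V x * ψ 0 x ^ 2) := by
  have hVc : Continuous V := hV.continuous
  have hV'c : Continuous (deriv V) := hV.continuous_deriv (by norm_num)
  obtain ⟨ψt, ψx, -, -, -, hct, hcx, -, -, -, h1, h2, -⟩ := exists_partials_of_contDiff_two hψ
  have hd1 : ∀ t x, deriv (fun τ => ψ τ x) t = ψt t x := fun t x => (h1 t x).deriv
  have hd2 : ∀ t x, deriv (ψ t) x = ψx t x := fun t x => (h2 t x).deriv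
  have hψ' : Continuous fun p : ℝ × ℝ => ψ p.1 p.2 := hψ.continuous
  have hψt' : Continuous fun p : ℝ × ℝ => ψt p.1 p.2 := hct
  have hψx' : Continuous fun p : ℝ × ℝ => ψx p.1 p.2 := hcx
  -- the smooth continuation of the optimal weight
  have hβc : Continuous β := hβC.continuous
  have hβ'c : Continuous (deriv β) := hβC.continuous_deriv (by norm_num)
  have hαβ : ∀ v, 0 ≤ α₀ - β v := fun v => by linarith [hβle v]
  have hα1 : 1 ≤ α₀ := le_trans hβw (hβle xw)
  -- the three identities
  have IB := wave1D_nullMultiplier_trapezoid_identity (α := fun _ => α₀) (β := β) hV contDiff_const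
    hβC hψ hsol (a := b) (b := xw) (s := 0) (t := t) ht (by linarith)
  have IS := wave1D_nullMultiplier_trapezoid_identity (α := fun _ => α₀) (β := β) hV contDiff_const
    hβC hψ hsol (a := b) (b := xe) (s := 0) (t := t) ht hb
  have IZ := wave1D_nullMultiplier_trapezoid_identity (α := fun _ => α₀) (β := fun _ => (0 : ℝ)) hV
    contDiff_const contDiff_const hψ hsol (a := b) (b := xe) (s := 0) (t := t) ht hb
  simp only [zero_add, add_zero, sub_zero, deriv_const', mul_zero, zero_mul, hd1, hd2] at IB IS IZ
  simp only [hd1, hd2]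
  -- (f1) the big top = the small top + the strip top, the latter non-negative
  have hcT : Continuous fun x => β (t + x) * (ψt t x + ψx t x) ^ 2 + α₀ * (ψt t x - ψx t x) ^ 2
      + (α₀ + β (t + x)) * V x * ψ t x ^ 2 := by fun_prop
  have f1 : (∫ x in (b + t)..(xw - t), (β (t + x) * (ψt t x + ψx t x) ^ 2
        + α₀ * (ψt t x - ψx t x) ^ 2 + (α₀ + β (t + x)) * V x * ψ t x ^ 2))
      = (∫ x in (b + t)..(xe - t), (β (t + x) * (ψt t x + ψx t x) ^ 2
          + α₀ * (ψt t x - ψx t x) ^ 2 + (α₀ + β (t + x)) * V x * ψ t x ^ 2))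
        + ∫ x in (xe - t)..(xw - t), (β (t + x) * (ψt t x + ψx t x) ^ 2
          + α₀ * (ψt t x - ψx t x) ^ 2 + (α₀ + β (t + x)) * V x * ψ t x ^ 2) :=
    (integral_add_adjacent_intervals (hcT.intervalIntegrable _ _) (hcT.intervalIntegrable _ _)).symm
  have f1' : 0 ≤ ∫ x in (xe - t)..(xw - t), (β (t + x) * (ψt t x + ψx t x) ^ 2
      + α₀ * (ψt t x - ψx t x) ^ 2 + (α₀ + β (t + x)) * V x * ψ t x ^ 2) :=
    intervalIntegral.integral_nonneg (by linarith) fun x hx => by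
      have hb2 : 0 ≤ β (t + x) := hβpos _ (by linarith [hx.1])
      have hv := hV0 x
      positivity
  -- (f2) the big base = the small base (the data vanish on `[xe, xw]`)
  have hc0 : Continuous fun x => β x * (ψt 0 x + ψx 0 x) ^ 2 + α₀ * (ψt 0 x - ψx 0 x) ^ 2
      + (α₀ + β x) * V x * ψ 0 x ^ 2 := by fun_prop
  have hzero : ∀ x, xe < x → ψ 0 x = 0 ∧ ψt 0 x = 0 ∧ ψx 0 x = 0 := by
    intro x hx
    refine ⟨(hsupp x hx.le).1, by rw [← hd1]; exact (hsupp x hx.le).2, ?_⟩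
    rw [← hd2]
    have hev : (ψ 0) =ᶠ[𝓝 x] fun _ => (0 : ℝ) := by
      filter_upwards [Ioi_mem_nhds hx] with y hy using (hsupp y (le_of_lt hy)).1
    rw [hev.deriv_eq, deriv_const]
  have f2 : (∫ x in b..xw, (β x * (ψt 0 x + ψx 0 x) ^ 2 + α₀ * (ψt 0 x - ψx 0 x) ^ 2
        + (α₀ + β x) * V x * ψ 0 x ^ 2))
      = ∫ x in b..xe, (β x * (ψt 0 x + ψx 0 x) ^ 2 + α₀ * (ψt 0 x - ψx 0 x) ^ 2
        + (α₀ + β x) * V x * ψ 0 x ^ 2) := by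
    rw [← integral_add_adjacent_intervals (hc0.intervalIntegrable b xe) (hc0.intervalIntegrable xe xw)]
    have hz : (∫ x in xe..xw, (β x * (ψt 0 x + ψx 0 x) ^ 2 + α₀ * (ψt 0 x - ψx 0 x) ^ 2
        + (α₀ + β x) * V x * ψ 0 x ^ 2)) = 0 := by
      rw [integral_of_le hew]
      refine setIntegral_eq_zero_of_forall_eq_zero fun x hx => ?_
      obtain ⟨h0, ht0, hx0⟩ := hzero x hx.1
      simp [h0, ht0, hx0]
    rw [hz, add_zero]
  -- (f3) the small roof with `β` = the small roof with `β ≡ 0` (`β xe = 0`)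
  have f3 : (∫ x in (xe - t)..xe, (2 * α₀ * (ψt (xe - x) x - ψx (xe - x) x) ^ 2
        + 2 * β xe * V x * ψ (xe - x) x ^ 2))
      = ∫ x in (xe - t)..xe, 2 * α₀ * (ψt (xe - x) x - ψx (xe - x) x) ^ 2 := by
    refine integral_congr fun x _ => ?_
    simp only [hβe]
    ring
  -- (f4) the big bulk = the small bulk + the strip bulk, the latter non-positive
  set S : ℝ → ℝ → ℝ := fun τ x =>
    (2 * deriv β (τ + x) * V x + (β (τ + x) - α₀) * deriv V x) * ψ τ x ^ 2 with hS
  have hSc : Continuous (Function.uncurry S) := by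
    show Continuous fun p : ℝ × ℝ =>
      (2 * deriv β (p.1 + p.2) * V p.2 + (β (p.1 + p.2) - α₀) * deriv V p.2) * ψ p.1 p.2 ^ 2
    fun_prop
  have hSnp : ∀ τ x, 0 ≤ τ → x ≤ xw → S τ x ≤ 0 := by
    intro τ x hτ hx
    simp only [hS]
    have h1' := hmono x hx
    have h2' := hαβ (τ + x)
    have h3' := hV0 x
    have h4' : k (τ + x) ≤ k x := hka (by linarith)
    have h5' : 2 * k (τ + x) * V x ≤ deriv V x :=
      le_trans (by nlinarith [mul_le_mul_of_nonneg_right h4' h3']) h1'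
    have h6' : deriv β (τ + x) * V x ≤ k (τ + x) * (α₀ - β (τ + x)) * V x :=
      mul_le_mul_of_nonneg_right (hβ' (τ + x)) h3'
    have hco : 2 * deriv β (τ + x) * V x + (β (τ + x) - α₀) * deriv V x ≤ 0 := by
      nlinarith [mul_le_mul_of_nonneg_left h5' h2']
    exact mul_nonpos_of_nonpos_of_nonneg hco (sq_nonneg _)
  have hGc : Continuous fun τ => ∫ x in (b + τ)..(xe - τ), S τ x :=
    continuous_trapezoidSlice_integral hSc b xe
  have hHc : Continuous fun τ => ∫ x in (xe + τ)..(xw - τ), S τ x :=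
    continuous_trapezoidSlice_integral hSc xe xw
  have hinner : ∀ τ, (∫ x in (b + τ)..(xw - τ), S τ x)
      = (∫ x in (b + τ)..(xe - τ), S τ x) + ∫ x in (xe - τ)..(xw - τ), S τ x := by
    intro τ
    have hc : Continuous fun x => S τ x := hSc.comp (continuous_const.prodMk continuous_id)
    exact (integral_add_adjacent_intervals (hc.intervalIntegrable _ _) (hc.intervalIntegrable _ _)).symm
  have f4 : (∫ τ in (0 : ℝ)..t, ∫ x in (b + τ)..(xw - τ), S τ x)
      = (∫ τ in (0 : ℝ)..t, ∫ x in (b + τ)..(xe - τ), S τ x)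
        + ∫ τ in (0 : ℝ)..t, ∫ x in (xe - τ)..(xw - τ), S τ x := by
    have hH' : Continuous fun τ => ∫ x in (xe - τ)..(xw - τ), S τ x := by
      have heq : (fun τ => ∫ x in (xe - τ)..(xw - τ), S τ x)
          = fun τ => ∫ x in (xe + (-τ))..(xw - τ), S τ x := by
        funext τ; rw [← sub_eq_add_neg]
      have h1 : Continuous fun τ => ∫ x in (0 : ℝ)..(xw - τ), S τ x :=
        intervalIntegral.continuous_parametric_intervalIntegral_of_continuous hSc
          (continuous_const.sub continuous_id)
      have h2 : Continuous fun τ => ∫ x in (0 : ℝ)..(xe - τ), S τ x :=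
        intervalIntegral.continuous_parametric_intervalIntegral_of_continuous hSc
          (continuous_const.sub continuous_id)
      have heq2 : (fun τ => ∫ x in (xe - τ)..(xw - τ), S τ x)
          = fun τ => (∫ x in (0 : ℝ)..(xw - τ), S τ x) - ∫ x in (0 : ℝ)..(xe - τ), S τ x := by
        funext τ
        have hc : Continuous fun x => S τ x := hSc.comp (continuous_const.prodMk continuous_id)
        rw [integral_interval_sub_left (hc.intervalIntegrable _ _) (hc.intervalIntegrable _ _)]
      rw [heq2]
      exact h1.sub h2
    rw [← integral_add (hGc.intervalIntegrable _ _) (hH'.intervalIntegrable _ _)]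
    exact integral_congr fun τ _ => hinner τ
  have f4' : (∫ τ in (0 : ℝ)..t, ∫ x in (xe - τ)..(xw - τ), S τ x) ≤ 0 := by
    rw [integral_of_le ht]
    refine setIntegral_nonpos measurableSet_Ioc fun τ hτ => ?_
    rw [integral_of_le (by linarith)]
    exact setIntegral_nonpos measurableSet_Ioc fun x hx => hSnp τ x hτ.1.le (by linarith [hx.2, hτ.1])
  -- (f5) signs of the `β ≡ 0` identity
  have f5T : 0 ≤ ∫ x in (b + t)..(xe - t), (α₀ * (ψt t x - ψx t x) ^ 2 + α₀ * V x * ψ t x ^ 2) :=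
    intervalIntegral.integral_nonneg hb fun x _ => by
      have := hV0 x; positivity
  have f5L : 0 ≤ ∫ x in b..(b + t), 2 * α₀ * V x * ψ (x - b) x ^ 2 :=
    intervalIntegral.integral_nonneg (by linarith) fun x _ => by
      have := hV0 x; positivity
  have f5K : (∫ τ in (0 : ℝ)..t, ∫ x in (b + τ)..(xe - τ), (0 - α₀) * deriv V x * ψ τ x ^ 2) ≤ 0 := by
    rw [integral_of_le ht]
    refine setIntegral_nonpos measurableSet_Ioc fun τ hτ => ?_
    have hτt : τ ≤ t := hτ.2
    rw [integral_of_le (by linarith)]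
    refine setIntegral_nonpos measurableSet_Ioc fun x hx => ?_
    have hxw : x ≤ xw := by linarith [hx.2, hτ.1]
    have hV' : 0 ≤ deriv V x :=
      le_trans (by have := hV0 x; have := hk0 x; positivity) (hmono x hxw)
    have : (0 - α₀) * deriv V x ≤ 0 := by nlinarith
    exact mul_nonpos_of_nonpos_of_nonneg this (sq_nonneg _)
  -- (f6) the big roof dominates twice the energy flux
  have hcR : Continuous fun x => (ψt (xw - x) x - ψx (xw - x) x) ^ 2 + V x * ψ (xw - x) x ^ 2 := by
    fun_prop
  have hcR' : Continuous fun x => 2 * α₀ * (ψt (xw - x) x - ψx (xw - x) x) ^ 2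
      + 2 * β xw * V x * ψ (xw - x) x ^ 2 := by fun_prop
  have f6 : 2 * ∫ x in (xw - t)..xw, ((ψt (xw - x) x - ψx (xw - x) x) ^ 2 + V x * ψ (xw - x) x ^ 2)
      ≤ ∫ x in (xw - t)..xw, (2 * α₀ * (ψt (xw - x) x - ψx (xw - x) x) ^ 2
          + 2 * β xw * V x * ψ (xw - x) x ^ 2) := by
    rw [← intervalIntegral.integral_const_mul]
    refine intervalIntegral.integral_mono_on (by linarith) ((hcR.const_mul 2).intervalIntegrable _ _)
      (hcR'.intervalIntegrable _ _) fun x _ => ?_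
    have hv := hV0 x
    have hsq := sq_nonneg (ψt (xw - x) x - ψx (xw - x) x)
    have hψ2 := sq_nonneg (ψ (xw - x) x)
    nlinarith [mul_nonneg hv hψ2, mul_le_mul_of_nonneg_right hα1 hsq,
      mul_le_mul_of_nonneg_right hβw (mul_nonneg hv hψ2)]
  -- the base of the `β ≡ 0` identity is `α₀ ×` the right-hand side
  have f7 : (∫ x in b..xe, (α₀ * (ψt 0 x - ψx 0 x) ^ 2 + α₀ * V x * ψ 0 x ^ 2))
      = α₀ * ∫ x in b..xe, ((ψt 0 x - ψx 0 x) ^ 2 + V x * ψ 0 x ^ 2) := by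
    rw [← intervalIntegral.integral_const_mul]
    refine integral_congr fun x _ => ?_
    ring
  -- combine
  simp only [hS] at f4 f4' hinner
  rw [f1, f2, f4] at IB
  rw [f3] at IS
  rw [f7] at IZ
  linarith [IB, IS, IZ, f1', f4', f5T, f5L, f5K, f6]

/-- **Forward windowed estimate, variable rate.** Under the hypotheses of
`wave1D_roofFlux_le_variable`, if the
time-`0` energy below the window top is finite, then for every `t ≥ 0`
`ofReal (∫_{x ≤ x_w} e(0,·) − (α₀/2) ∫_{x ≤ x_e} [(ψ_t − ψ_x)² + Vψ²](0,·)) ≤ ∫⁻_{x < x_w − t} e(t,·)`.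
[folklore] -/
theorem wave1D_nearWindow_forward_ge_variable (hV : ContDiff ℝ 1 V) (hV0 : ∀ x, 0 ≤ V x)
    {k : ℝ → ℝ} {xe xw : ℝ} (hk : Continuous k) (hk0 : ∀ x, 0 ≤ k x) (hka : Antitone k)
    (hmono : ∀ x, x ≤ xw → 2 * k x * V x ≤ deriv V x) (hew : xe ≤ xw) {α₀ : ℝ}
    (hα0 : 0 ≤ α₀) (hαw : 1 ≤ α₀ * (1 - Real.exp (-(∫ y in xe..xw, k y))))
    (hψ : ContDiff ℝ 2 (Function.uncurry ψ))
    (hsol : ∀ t x, iteratedDeriv 2 (fun τ => ψ τ x) t - iteratedDeriv 2 (ψ t) x + V x * ψ t x = 0)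
    (hsupp : ∀ x, xe ≤ x → ψ 0 x = 0 ∧ deriv (fun τ => ψ τ x) 0 = 0)
    (hfin : ∫⁻ x in Iic xw, ENNReal.ofReal
        (deriv (fun τ => ψ τ x) 0 ^ 2 + deriv (ψ 0) x ^ 2 + V x * ψ 0 x ^ 2) ≠ ⊤)
    {t : ℝ} (ht : 0 ≤ t) :
    ENNReal.ofReal ((∫ x in Iic xw,
        (deriv (fun τ => ψ τ x) 0 ^ 2 + deriv (ψ 0) x ^ 2 + V x * ψ 0 x ^ 2))
          - (α₀ / 2) * ∫ x in Iic xe,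
            ((deriv (fun τ => ψ τ x) 0 - deriv (ψ 0) x) ^ 2 + V x * ψ 0 x ^ 2))
      ≤ ∫⁻ x in Iio (xw - t), ENNReal.ofReal
        (deriv (fun τ => ψ τ x) t ^ 2 + deriv (ψ t) x ^ 2 + V x * ψ t x ^ 2) := by
  have hVc : Continuous V := hV.continuous
  obtain ⟨ψt, ψx, -, -, -, hct, hcx, -, -, -, h1, h2, -⟩ := exists_partials_of_contDiff_two hψ
  have hd1 : ∀ t x, deriv (fun τ => ψ τ x) t = ψt t x := fun t x => (h1 t x).deriv
  have hd2 : ∀ t x, deriv (ψ t) x = ψx t x := fun t x => (h2 t x).deriv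
  -- the ODE weight `β(v) = α₀ (1 − exp(−∫_{xe}^v k))`
  obtain ⟨β, hβC, hβe, hβpos, hβle, hβ', hβw⟩ :
      ∃ β : ℝ → ℝ, ContDiff ℝ 1 β ∧ β xe = 0 ∧ (∀ v, xe ≤ v → 0 ≤ β v) ∧ (∀ v, β v ≤ α₀)
        ∧ (∀ v, deriv β v ≤ k v * (α₀ - β v)) ∧ 1 ≤ β xw :=
    exists_odeWeight hk hk0 xe hα0 hαw
  set e0 : ℝ → ℝ := fun x => deriv (fun τ => ψ τ x) 0 ^ 2 + deriv (ψ 0) x ^ 2 + V x * ψ 0 x ^ 2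
    with he0
  set Z0 : ℝ → ℝ := fun x => (deriv (fun τ => ψ τ x) 0 - deriv (ψ 0) x) ^ 2 + V x * ψ 0 x ^ 2
    with hZ0
  have he0_nn : ∀ x, 0 ≤ e0 x := fun x => wave1D_energyDensity_nonneg hV0 0 x
  have hZ0_nn : ∀ x, 0 ≤ Z0 x := fun x => by
    simp only [hZ0]; have := hV0 x; positivity
  have hZ0_le : ∀ x, Z0 x ≤ 2 * e0 x := fun x => by
    simp only [hZ0, he0]
    have hv := hV0 x
    nlinarith [sq_nonneg (deriv (fun τ => ψ τ x) 0 + deriv (ψ 0) x),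
      mul_nonneg hv (sq_nonneg (ψ 0 x))]
  have he0_cont : Continuous e0 := by
    simp only [he0, hd1, hd2]
    have ha : Continuous fun p : ℝ × ℝ => ψt p.1 p.2 := hct
    have hb' : Continuous fun p : ℝ × ℝ => ψx p.1 p.2 := hcx
    have hc : Continuous fun p : ℝ × ℝ => ψ p.1 p.2 := hψ.continuous
    fun_prop
  have hZ0_cont : Continuous Z0 := by
    simp only [hZ0, hd1, hd2]
    have ha : Continuous fun p : ℝ × ℝ => ψt p.1 p.2 := hct
    have hb' : Continuous fun p : ℝ × ℝ => ψx p.1 p.2 := hcx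
    have hc : Continuous fun p : ℝ × ℝ => ψ p.1 p.2 := hψ.continuous
    fun_prop
  have he0_int : IntegrableOn e0 (Iic xw) := by
    refine ⟨he0_cont.aestronglyMeasurable, ?_⟩
    rw [hasFiniteIntegral_iff_ofReal (ae_of_all _ fun x => he0_nn x)]
    exact lt_top_iff_ne_top.2 hfin
  have he0_int' : IntegrableOn e0 (Iic xe) := he0_int.mono_set (Iic_subset_Iic.2 hew)
  have hZ0_int : IntegrableOn Z0 (Iic xe) := by
    refine Integrable.mono' (he0_int'.const_mul 2) hZ0_cont.aestronglyMeasurable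
      (ae_of_all _ fun x => ?_)
    rw [Real.norm_eq_abs, abs_of_nonneg (hZ0_nn x)]
    exact hZ0_le x
  set R : ℝ := (α₀ / 2) * ∫ x in Iic xe, Z0 x with hR
  have htrunc : ∀ y, y ≤ xe →
      ENNReal.ofReal ((∫ x in y..xw, e0 x) - R)
        ≤ ∫⁻ x in Iio (xw - t), ENNReal.ofReal
          (deriv (fun τ => ψ τ x) t ^ 2 + deriv (ψ t) x ^ 2 + V x * ψ t x ^ 2) := by
    intro y hy
    have hb : (y - 2 * t) + 2 * t ≤ xw := by linarith
    have hge := wave1D_truncated_energy_ge hVc hV0 hψ hsol (a := xw) (b := y - 2 * t) ht hb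
    have hroof := wave1D_roofFlux_le_of_weight hV hV0 hk0 hka hmono hew hα0 hβC hβe hβpos hβle hβ'
      hβw hψ hsol hsupp (b := y - 2 * t) ht (by linarith)
    have hZmono : (∫ x in (y - 2 * t)..xe, Z0 x) ≤ ∫ x in Iic xe, Z0 x := by
      rw [integral_of_le (by linarith)]
      exact setIntegral_mono_set hZ0_int (ae_of_all _ fun x => hZ0_nn x)
        (ae_of_all _ Ioc_subset_Iic_self)
    have hy2 : y - 2 * t + 2 * t = y := by ring
    rw [hy2] at hge
    have hα2 : 0 ≤ α₀ / 2 := by linarith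
    have hstep : (∫ x in y..xw, e0 x) - R
        ≤ ∫ x in (y - 2 * t + t)..(xw - t),
          (deriv (fun τ => ψ τ x) t ^ 2 + deriv (ψ t) x ^ 2 + V x * ψ t x ^ 2) := by
      simp only [hR, he0]
      have hZ : (∫ x in (y - 2 * t)..xe, Z0 x) = ∫ x in (y - 2 * t)..xe,
          ((deriv (fun τ => ψ τ x) 0 - deriv (ψ 0) x) ^ 2 + V x * ψ 0 x ^ 2) := by simp only [hZ0]
      rw [← hZ] at hroof
      nlinarith [mul_le_mul_of_nonneg_left hZmono hα2]
    calc ENNReal.ofReal ((∫ x in y..xw, e0 x) - R)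
        ≤ ENNReal.ofReal (∫ x in (y - 2 * t + t)..(xw - t),
            (deriv (fun τ => ψ τ x) t ^ 2 + deriv (ψ t) x ^ 2 + V x * ψ t x ^ 2)) :=
          ENNReal.ofReal_le_ofReal hstep
      _ = ∫⁻ x in Ioc (y - 2 * t + t) (xw - t), ENNReal.ofReal
            (deriv (fun τ => ψ τ x) t ^ 2 + deriv (ψ t) x ^ 2 + V x * ψ t x ^ 2) :=
          (lintegral_Ioc_wave1D_energy_eq hVc hV0 hψ t (by linarith)).symm
      _ ≤ ∫⁻ x in Iic (xw - t), ENNReal.ofReal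
            (deriv (fun τ => ψ τ x) t ^ 2 + deriv (ψ t) x ^ 2 + V x * ψ t x ^ 2) :=
          lintegral_mono_set Ioc_subset_Iic_self
      _ = ∫⁻ x in Iio (xw - t), ENNReal.ofReal
            (deriv (fun τ => ψ τ x) t ^ 2 + deriv (ψ t) x ^ 2 + V x * ψ t x ^ 2) :=
          (setLIntegral_congr (Iio_ae_eq_Iic (μ := volume) (a := xw - t))).symm
  have hlim : Tendsto (fun y => ENNReal.ofReal ((∫ x in y..xw, e0 x) - R)) atBot
      (𝓝 (ENNReal.ofReal ((∫ x in Iic xw, e0 x) - R))) := by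
    have h1 : Tendsto (fun y => ∫ x in y..xw, e0 x) atBot (𝓝 (∫ x in Iic xw, e0 x)) :=
      intervalIntegral_tendsto_integral_Iic xw he0_int tendsto_id
    exact ENNReal.continuous_ofReal.continuousAt.tendsto.comp (h1.sub_const R)
  have hmain := le_of_tendsto hlim (Filter.Eventually.mono (eventually_le_atBot xe) htrunc)
  simpa only [hR, he0, hZ0] using hmain

/-- **Windowed channel inequality on the growing side of the potential, variable rate.** Let
`V ∈ C¹`, `V ≥ 0`, `k ≥ 0` continuous and non-increasing with `V′ ≥ 2kV` on `(−∞, x_w]`, `h > 0`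
with `∫_{x_w−h}^{x_w} k > 0`, and let `ψ` be a global `C²` solution of `ψ_tt − ψ_xx + V(x)ψ = 0`
whose Cauchy data vanish on `[x_w − h, ∞)`. Then, with `e = ψ_t² + ψ_x² + Vψ²` and
`θ = exp(−∫_{x_w−h}^{x_w} k)`,
`((1 − 2θ)/(1 − θ)) · ∫ e(0,·) ≤ liminf_{t→+∞} ∫_{x < x_w − t} e(t,·) + liminf_{t→−∞} ∫_{x < x_w + t} e(t,·)`
(lower Lebesgue integrals; infinite energy allowed; positive constant iff `∫ k > log 2`). [folklore] -/
theorem wave1D_nearWindowedChannel_variable (hV : ContDiff ℝ 1 V) (hV0 : ∀ x, 0 ≤ V x)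
    {k : ℝ → ℝ} {xw h : ℝ} (hk : Continuous k) (hk0 : ∀ x, 0 ≤ k x) (hka : Antitone k)
    (hh : 0 < h) (hpos : 0 < ∫ y in (xw - h)..xw, k y)
    (hmono : ∀ x, x ≤ xw → 2 * k x * V x ≤ deriv V x)
    (hψ : ContDiff ℝ 2 (Function.uncurry ψ))
    (hsol : ∀ t x, iteratedDeriv 2 (fun τ => ψ τ x) t - iteratedDeriv 2 (ψ t) x + V x * ψ t x = 0)
    (hsupp : ∀ x, xw - h ≤ x → ψ 0 x = 0 ∧ deriv (fun τ => ψ τ x) 0 = 0) :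
    ENNReal.ofReal ((1 - 2 * Real.exp (-(∫ y in (xw - h)..xw, k y)))
          / (1 - Real.exp (-(∫ y in (xw - h)..xw, k y))))
        * ∫⁻ x, ENNReal.ofReal (deriv (fun τ => ψ τ x) 0 ^ 2 + deriv (ψ 0) x ^ 2 + V x * ψ 0 x ^ 2)
      ≤ liminf (fun t => ∫⁻ x in Iio (xw - t), ENNReal.ofReal
            (deriv (fun τ => ψ τ x) t ^ 2 + deriv (ψ t) x ^ 2 + V x * ψ t x ^ 2)) atTop
        + liminf (fun t => ∫⁻ x in Iio (xw + t), ENNReal.ofReal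
            (deriv (fun τ => ψ τ x) t ^ 2 + deriv (ψ t) x ^ 2 + V x * ψ t x ^ 2)) atBot := by
  have hVc : Continuous V := hV.continuous
  obtain ⟨ψt, ψx, -, -, -, hct, hcx, -, -, -, h1, h2, -⟩ := exists_partials_of_contDiff_two hψ
  have hd1 : ∀ t x, deriv (fun τ => ψ τ x) t = ψt t x := fun t x => (h1 t x).deriv
  have hd2 : ∀ t x, deriv (ψ t) x = ψx t x := fun t x => (h2 t x).deriv
  set xe : ℝ := xw - h with hxe
  have hew : xe ≤ xw := by simp only [hxe]; linarith
  set e0 : ℝ → ℝ := fun x => deriv (fun τ => ψ τ x) 0 ^ 2 + deriv (ψ 0) x ^ 2 + V x * ψ 0 x ^ 2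
    with he0
  have he0_nn : ∀ x, 0 ≤ e0 x := fun x => wave1D_energyDensity_nonneg hV0 0 x
  have he0_cont : Continuous e0 := by
    simp only [he0, hd1, hd2]
    have ha : Continuous fun p : ℝ × ℝ => ψt p.1 p.2 := hct
    have hb' : Continuous fun p : ℝ × ℝ => ψx p.1 p.2 := hcx
    have hc : Continuous fun p : ℝ × ℝ => ψ p.1 p.2 := hψ.continuous
    fun_prop
  have he0_zero : ∀ x, xe < x → e0 x = 0 := by
    intro x hx
    have hψ0 : ψ 0 x = 0 := (hsupp x hx.le).1
    have hψt0 : deriv (fun τ => ψ τ x) 0 = 0 := (hsupp x hx.le).2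
    have hψx0 : deriv (ψ 0) x = 0 := by
      have hev : (ψ 0) =ᶠ[𝓝 x] fun _ => (0 : ℝ) := by
        filter_upwards [Ioi_mem_nhds hx] with y hy using (hsupp y (le_of_lt hy)).1
      rw [hev.deriv_eq, deriv_const]
    simp only [he0, hψ0, hψt0, hψx0]
    ring
  -- infinite energy
  by_cases htop : ∫⁻ x in Iio xw, ENNReal.ofReal (e0 x) = ⊤
  · have hfw : ∀ t, 0 ≤ t → (∫⁻ x in Iio (xw - t), ENNReal.ofReal
        (deriv (fun τ => ψ τ x) t ^ 2 + deriv (ψ t) x ^ 2 + V x * ψ t x ^ 2)) = ⊤ := fun t ht =>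
      wave1D_lintegral_Iio_energy_eq_top_of_nonneg hVc hV0 hψ hsol htop ht
    have hlim : liminf (fun t => ∫⁻ x in Iio (xw - t), ENNReal.ofReal
        (deriv (fun τ => ψ τ x) t ^ 2 + deriv (ψ t) x ^ 2 + V x * ψ t x ^ 2)) atTop = ⊤ := by
      refine top_unique (le_liminf_of_le (h := ?_))
      filter_upwards [eventually_ge_atTop 0] with t ht
      exact (hfw t ht).ge
    rw [hlim, top_add]
    exact le_top
  have hfinIic : ∫⁻ x in Iic xw, ENNReal.ofReal (e0 x) ≠ ⊤ := by
    rwa [← setLIntegral_congr (Iio_ae_eq_Iic (μ := volume) (a := xw))]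
  -- the weight constant
  set q : ℝ := Real.exp (-(∫ y in (xw - h)..xw, k y)) with hq
  have hq1 : q < 1 := by
    rw [hq, Real.exp_lt_one_iff]
    linarith
  have hqpos : 0 < q := Real.exp_pos _
  set α₀ : ℝ := 1 / (1 - q) with hα₀
  have hα0 : 0 ≤ α₀ := by simp only [hα₀]; exact div_nonneg zero_le_one (by linarith)
  have hαw : 1 ≤ α₀ * (1 - Real.exp (-(∫ y in xe..xw, k y))) := by
    rw [hxe, ← hq, hα₀, div_mul_cancel₀ (1 : ℝ) (by linarith : (1 - q) ≠ 0)]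
  -- forward estimates for `ψ` and its time reversal
  have hF := fun (t : ℝ) (ht : 0 ≤ t) =>
    wave1D_nearWindow_forward_ge_variable hV hV0 hk hk0 hka hmono hew hα0 hαw hψ hsol hsupp hfinIic ht
  obtain ⟨hψ', hsol', he'⟩ := wave1D_timeReversal hψ hsol
  have hdn : ∀ x, deriv (fun τ => (fun t x => ψ (-t) x) τ x) 0 = -deriv (fun τ => ψ τ x) 0 := by
    intro x
    have := deriv_comp_neg (fun τ => ψ τ x) 0
    simpa using this
  have hsupp' : ∀ x, xe ≤ x → (fun t x => ψ (-t) x) 0 x = 0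
      ∧ deriv (fun τ => (fun t x => ψ (-t) x) τ x) 0 = 0 := by
    intro x hx
    refine ⟨by simpa using (hsupp x hx).1, ?_⟩
    rw [hdn x, (hsupp x hx).2, neg_zero]
  have hfinIic' : ∫⁻ x in Iic xw, ENNReal.ofReal (deriv (fun τ => (fun t x => ψ (-t) x) τ x) 0 ^ 2
      + deriv ((fun t x => ψ (-t) x) 0) x ^ 2 + V x * (fun t x => ψ (-t) x) 0 x ^ 2) ≠ ⊤ := by
    simp only [he', neg_zero]
    exact hfinIic
  have hB := fun (t : ℝ) (ht : 0 ≤ t) =>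
    wave1D_nearWindow_forward_ge_variable hV hV0 hk hk0 hka hmono hew hα0 hαw hψ' hsol' hsupp' hfinIic' ht
  set Ew : ℝ := ∫ x in Iic xw, e0 x with hEw
  set Rp : ℝ := (α₀ / 2) * ∫ x in Iic xe,
    ((deriv (fun τ => ψ τ x) 0 - deriv (ψ 0) x) ^ 2 + V x * ψ 0 x ^ 2) with hRp
  set Rm : ℝ := (α₀ / 2) * ∫ x in Iic xe,
    ((-deriv (fun τ => ψ τ x) 0 - deriv (ψ 0) x) ^ 2 + V x * ψ 0 x ^ 2) with hRm
  have hfwd : ENNReal.ofReal (Ew - Rp) ≤ liminf (fun t => ∫⁻ x in Iio (xw - t), ENNReal.ofReal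
      (deriv (fun τ => ψ τ x) t ^ 2 + deriv (ψ t) x ^ 2 + V x * ψ t x ^ 2)) atTop := by
    refine le_liminf_of_le (h := ?_)
    filter_upwards [eventually_ge_atTop 0] with t ht
    exact hF t ht
  have hbwd : ENNReal.ofReal (Ew - Rm) ≤ liminf (fun t => ∫⁻ x in Iio (xw + t), ENNReal.ofReal
      (deriv (fun τ => ψ τ x) t ^ 2 + deriv (ψ t) x ^ 2 + V x * ψ t x ^ 2)) atBot := by
    refine le_liminf_of_le (h := ?_)
    filter_upwards [eventually_le_atBot 0] with t ht
    have hb := hB (-t) (by linarith)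
    simp only [he', neg_neg, neg_zero, hdn] at hb
    have hset : xw - -t = xw + t := by ring
    rw [hset] at hb
    refine le_trans (le_of_eq ?_) (le_of_le_of_eq hb rfl)
    congr 1
    rw [hEw, hRm]
    congr 1
    simp only [he0]
    congr 1
    funext x
    ring
  -- energy bookkeeping at time `0`
  have he0_int : IntegrableOn e0 (Iic xw) := by
    refine ⟨he0_cont.aestronglyMeasurable, ?_⟩
    rw [hasFiniteIntegral_iff_ofReal (ae_of_all _ fun x => he0_nn x)]
    exact lt_top_iff_ne_top.2 hfinIic
  have he0_int' : IntegrableOn e0 (Iic xe) := he0_int.mono_set (Iic_subset_Iic.2 hew)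
  set Ee : ℝ := ∫ x in Iic xe, e0 x with hEe
  have hEwe : Ew = Ee := by
    rw [hEw, hEe, ← Iic_union_Ioc_eq_Iic hew,
      setIntegral_union (Iic_disjoint_Ioc le_rfl) measurableSet_Ioc he0_int'
        (he0_int.mono_set Ioc_subset_Iic_self)]
    have hz : (∫ x in Ioc xe xw, e0 x) = 0 :=
      setIntegral_eq_zero_of_forall_eq_zero fun x hx => he0_zero x hx.1
    rw [hz, add_zero]
  have hsum : Rp + Rm = α₀ * Ee := by
    have hc1 : Continuous fun x => (deriv (fun τ => ψ τ x) 0 - deriv (ψ 0) x) ^ 2 + V x * ψ 0 x ^ 2 := by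
      simp only [hd1, hd2]
      have ha : Continuous fun p : ℝ × ℝ => ψt p.1 p.2 := hct
      have hb' : Continuous fun p : ℝ × ℝ => ψx p.1 p.2 := hcx
      have hc : Continuous fun p : ℝ × ℝ => ψ p.1 p.2 := hψ.continuous
      fun_prop
    have hc2 : Continuous fun x => (-deriv (fun τ => ψ τ x) 0 - deriv (ψ 0) x) ^ 2 + V x * ψ 0 x ^ 2 := by
      simp only [hd1, hd2]
      have ha : Continuous fun p : ℝ × ℝ => ψt p.1 p.2 := hct
      have hb' : Continuous fun p : ℝ × ℝ => ψx p.1 p.2 := hcx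
      have hc : Continuous fun p : ℝ × ℝ => ψ p.1 p.2 := hψ.continuous
      fun_prop
    have hle1 : ∀ x, |(deriv (fun τ => ψ τ x) 0 - deriv (ψ 0) x) ^ 2 + V x * ψ 0 x ^ 2| ≤ 2 * e0 x := by
      intro x
      have hv := hV0 x
      rw [abs_of_nonneg (by positivity)]
      simp only [he0]
      nlinarith [sq_nonneg (deriv (fun τ => ψ τ x) 0 + deriv (ψ 0) x), mul_nonneg hv (sq_nonneg (ψ 0 x))]
    have hle2 : ∀ x, |(-deriv (fun τ => ψ τ x) 0 - deriv (ψ 0) x) ^ 2 + V x * ψ 0 x ^ 2| ≤ 2 * e0 x := by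
      intro x
      have hv := hV0 x
      rw [abs_of_nonneg (by positivity)]
      simp only [he0]
      nlinarith [sq_nonneg (-deriv (fun τ => ψ τ x) 0 + deriv (ψ 0) x), mul_nonneg hv (sq_nonneg (ψ 0 x))]
    have hi1 : IntegrableOn (fun x => (deriv (fun τ => ψ τ x) 0 - deriv (ψ 0) x) ^ 2 + V x * ψ 0 x ^ 2)
        (Iic xe) :=
      Integrable.mono' (he0_int'.const_mul 2) hc1.aestronglyMeasurable
        (ae_of_all _ fun x => by rw [Real.norm_eq_abs]; exact hle1 x)
    have hi2 : IntegrableOn (fun x => (-deriv (fun τ => ψ τ x) 0 - deriv (ψ 0) x) ^ 2 + V x * ψ 0 x ^ 2)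
        (Iic xe) :=
      Integrable.mono' (he0_int'.const_mul 2) hc2.aestronglyMeasurable
        (ae_of_all _ fun x => by rw [Real.norm_eq_abs]; exact hle2 x)
    rw [hRp, hRm, ← mul_add, ← integral_add hi1 hi2, hEe]
    have hpt : (fun x => (deriv (fun τ => ψ τ x) 0 - deriv (ψ 0) x) ^ 2 + V x * ψ 0 x ^ 2
        + ((-deriv (fun τ => ψ τ x) 0 - deriv (ψ 0) x) ^ 2 + V x * ψ 0 x ^ 2))
        = fun x => 2 * e0 x := by
      funext x; simp only [he0]; ring
    rw [hpt, MeasureTheory.integral_const_mul]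
    ring
  -- the total energy is the energy below `xe`
  have htot : (∫⁻ x, ENNReal.ofReal (e0 x)) = ENNReal.ofReal Ee := by
    have hsplit := lintegral_add_compl (μ := volume) (fun x => ENNReal.ofReal (e0 x))
      (measurableSet_Iic (a := xe))
    have hzero : (∫⁻ x in (Iic xe)ᶜ, ENNReal.ofReal (e0 x)) = 0 := by
      rw [compl_Iic]
      refine setLIntegral_eq_zero measurableSet_Ioi ?_
      intro x hx
      simp [he0_zero x (mem_Ioi.1 hx)]
    rw [← hsplit, hzero, add_zero,
      ofReal_integral_eq_lintegral_ofReal he0_int' (ae_of_all _ fun x => he0_nn x)]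
  -- conclusion
  have hEe0 : 0 ≤ Ee := setIntegral_nonneg measurableSet_Iic fun x _ => he0_nn x
  have hconst : (1 - 2 * q) / (1 - q) = 2 - α₀ := by
    have h1q : (1 - q) ≠ 0 := by linarith
    rw [hα₀]
    field_simp
    ring
  rcases le_or_gt ((1 - 2 * q) / (1 - q)) 0 with hc | hc
  · rw [ENNReal.ofReal_of_nonpos hc, zero_mul]
    exact bot_le
  have hAB : (2 - α₀) * Ee ≤ (Ew - Rp) + (Ew - Rm) := by
    rw [hEwe]
    nlinarith [hsum]
  calc ENNReal.ofReal ((1 - 2 * q) / (1 - q)) * ∫⁻ x, ENNReal.ofReal (e0 x)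
      = ENNReal.ofReal ((2 - α₀) * Ee) := by
        rw [htot, hconst, ← ENNReal.ofReal_mul (by linarith [hconst ▸ hc])]
    _ ≤ ENNReal.ofReal ((Ew - Rp) + (Ew - Rm)) := ENNReal.ofReal_le_ofReal hAB
    _ ≤ ENNReal.ofReal (Ew - Rp) + ENNReal.ofReal (Ew - Rm) := ENNReal.ofReal_add_le
    _ ≤ _ := add_le_add hfwd hbwd

end Variable

end Literature.Analysis.PDE
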